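import Literature.NumberTheory.ComplexMultiplication.EllipticUnits.ImaginaryQuadraticMainConjectureAllPrimes
import HarnessLib

/-!
# Sketch (stub-ideation k1 g33, technique «weaken / strengthen») for `stub_cmLambdaLower`
# (crux `ResidualThetaCountLowerPureAtTwo`, item stmt-BirchSwinnertonDyer-26074, route RTT)

Nothing here is registered text; nothing asserts a Literature fact; BSD is NOT proved by any of this.
`stub_cmLambdaLower` (= RSL_g, item 22608, VERBATIM) is CLOSED MOD PRINT on bt26_lambda v8
(p727151 ✓); its one content leaf is child B's PRINT body «Kato125AB», conjunct (LAM)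
`λ_𝒪(𝐇¹(T_g)/Λ_𝒪 z_g) ≤ λ_𝒪(X_fine)`, justified in print by the EQUALITY `ξ(𝐇²) = ξ(𝐇¹/Z)` in
`Λ ⊗ ℚ` for CM newforms (Burungale–Tian, Thm. 2.6 ⇐ Thm. 2.1 ⇐ Johnson-Leung–Kings 2011 §7.2 ⇐
JLK Thm. 5.2). k4-g30 booked the debt (ε1): at `p = 2` JLK Thm. 5.2's EQUALITY half imports the
unpublished preprint [It] (K. Itakura) through JLK Thm. 2.6 ([It] 3.1) and Prop. 2.9 ([It] 1.15).

WEAKEN (the print input, not the stub): JLK §6.3 (arXiv p0019:L34–p0020:L22) proves `Div(κ_η) = 0`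
for all characters `η` of big level `n` AT ONCE: every `Div(κ_η)` is EFFECTIVE (Euler systems,
Thm. 6.4 / Cor. 6.5 / Lemma 6.6 — (LAM-div) below) and "as the divisors are effective, they vanish
precisely when `∑_η Div(κ_η) = 0`"; the SUM vanishes by Cor. 2.8 (= TNC for `M(L)` ⊘ `M(F)`,
`L = K_n(𝔣_η)`, `F = K_{n-1}(𝔣_η)`) + Prop. 2.9 + Nakayama along the augmentation (Lemma 6.7) —
(LAM-tot) below. Hence the WEAKEST SUFFICIENT FORM of the [It] load under (LAM) is:
  (ε1a) TNC(`h⁰(Spec F′)`, `ℤ₂`) at `s = 0` for the TWO fields `F′ ∈ {K_{n-1}(𝔣_η), K_n(𝔣_η)}`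
        — abelian over the imaginary quadratic `K`, hence TOTALLY IMAGINARY;
  (ε1b) the `2`-integral Artin–Verdier `Det`-duality over `𝒪_K[1/2]` for the rank-one lattices
        `𝒪₂(η)` (JLK p0007:L127–129: "`RΓ` concentrated in degrees `≤ 2`", "`Ĥ⁰(ℝ, 𝒪₂(η⁻¹)^∨) = 0`").
Both are statements about number rings WITHOUT REAL PLACES, where the two `p = 2` defects that make
[HK1] say "up to powers of 2" (Prop. 1.2.10, arXiv p0007:L6–19: `RΓ(ℤ[1/2], ·)` not perfect;
`T_p^+` vs. Tate `Ĥ⁰(ℝ, ·)`) are vacuous; refereed loci: Burns–Flach 2006 (Doc. Math., Coates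
vol.) p. 133 L32–33 and §7.2 Prop. 7.2; Flach 2004 survey p. 2. (Card: Ideas/stub-cmlambdalower-k1-g33.md.)

STRENGTHEN (what the kernel certifies today, price 0): the summation step itself — "effective
divisors with zero sum vanish" — in the two currencies the line uses:
* §S1 `ℕ`-currency (λ-invariants on the cyclotomic line; lengths at one height-one prime):
  `nat_eq_of_le_of_sum_le`;
* §S2 ideal-currency over any Noetherian domain (the component `Λ_𝒪 ≅ 𝒪_𝔓⟦S,T⟧` of JLK (T1)):
  `factor_eq_top_of_prod_mul_eq`, `eq_of_dvd_of_prod_eq` (Nakayama: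
  `Submodule.exists_sub_one_mem_and_smul_eq_zero_of_fg_of_le_smul`);
* §S3 the same step on a FAMILY of the tree's `ZetaSkeleton`s (JLK Thm. 5.2 typed by
  `EllipticUnits/ImaginaryQuadraticMainConjectureAllPrimes.lean`): named predicates
  `EulerDivisibility` (= (LAM-div), Thm. 6.4 (4)/Cor. 6.5 in `char`-currency, refereed at every `p`)
  and `TotalCharIdentity` (= (LAM-tot), the ONLY [It]-dependent input at `p = 2`), and the PROVED
  implication `thm52CharShape_of_eulerDivisibility_of_totalCharIdentity :
  EulerDivisibility D s → TotalCharIdentity D s → (∀ i ∈ s, char(H² i) ≠ ⊥) → ∀ i ∈ s, (D i).Thm52CharShape`.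
Nothing in §S3 asserts that any skeleton satisfies either predicate.
-/

namespace Summit.BirchSwinnertonDyer.BirchSwinnertonDyer.Cruxes.ResidualThetaCountLowerPureAtTwo.SideaK1G33

open Literature.NumberTheory.ComplexMultiplication.EllipticUnits.JohnsonLeungKings2011
open Literature.NumberTheory.EllipticCurves

/-! ## §S1  `ℕ`-currency: termwise `≤` and total `≥` force termwise `=` -/

/-- **Summation step, `ℕ`-currency.** If `a i ≤ b i` termwise on `s` (Euler-system divisibility read
on λ-invariants / on lengths at one height-one prime) and `∑ b ≤ ∑ a` (the total identity, read the
cheap way round), then `a i = b i` termwise. Mathlib's `Finset.sum_eq_sum_iff_of_le`.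
[cite: JohnsonLeungKings2011, §6.3 ("As the divisors `Div(κ_η)` are effective, they vanish precisely when `∑_η Div(κ_η) = 0`", arXiv p0019:L120–127)] -/
theorem nat_eq_of_le_of_sum_le {ι : Type*} {s : Finset ι} {a b : ι → ℕ}
    (hle : ∀ i ∈ s, a i ≤ b i) (htot : ∑ i ∈ s, b i ≤ ∑ i ∈ s, a i) :
    ∀ i ∈ s, a i = b i :=
  (Finset.sum_eq_sum_iff_of_le hle).1 (le_antisymm (Finset.sum_le_sum hle) htot)

/-! ## §S2  Ideal-currency over a Noetherian domain -/

section IdealCurrency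

variable {Λ : Type*} [CommRing Λ] [IsDomain Λ] [IsNoetherianRing Λ] {ι : Type*}

/-- **Nakayama core.** In a Noetherian domain, a nonzero ideal `P` with `P * Q = P` forces `Q = ⊤`.
(`P` f.g.; `P ≤ Q • P` gives `r` with `r - 1 ∈ Q`, `r • P = 0`; `P ≠ ⊥` in a domain gives `r = 0`.)
[folklore] -/
theorem eq_top_of_mul_eq_self {P Q : Ideal Λ} (hP : P ≠ ⊥) (h : P * Q = P) : Q = ⊤ := by
  have hfg : P.FG := (isNoetherian_def.mp inferInstance) P
  have hle : P ≤ Q • P := by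
    rw [Ideal.smul_eq_mul, mul_comm, h]
  obtain ⟨r, hr1, hr⟩ := Submodule.exists_sub_one_mem_and_smul_eq_zero_of_fg_of_le_smul Q P hfg hle
  obtain ⟨x, hxP, hx0⟩ := Submodule.exists_mem_ne_zero_of_ne_bot hP
  have hr0 : r = 0 := by
    have := hr x hxP
    rw [smul_eq_mul] at this
    rcases mul_eq_zero.mp this with h0 | h0
    · exact h0
    · exact absurd h0 hx0
  rw [hr0, zero_sub] at hr1
  exact (Ideal.eq_top_iff_one Q).mpr (by simpa using Q.neg_mem hr1)

/-- **Summation step, ideal-currency (effective divisors with zero sum vanish).** If `J i = I i * D i`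
on `s` (each `D i` an "effective divisor": `I i ∣ J i`), every `I i ≠ ⊥`, and the totals agree
`∏ J = ∏ I`, then every `D i = ⊤`. Intended instance (JLK §6.3, one regular component `Λ_𝒪`):
`I η = char(H²(𝒪_K[1/p], Λ(η)(1)))`, `J η = char(H¹/𝒥_Λ(ζ(η)))`, `D η ↔ Div(κ_η)`.
[cite: JohnsonLeungKings2011, §6.3 (arXiv p0019:L114–127)] -/
theorem factor_eq_top_of_prod_mul_eq {s : Finset ι} {I J D : ι → Ideal Λ}
    (hI : ∀ i ∈ s, I i ≠ ⊥) (hdiv : ∀ i ∈ s, J i = I i * D i)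
    (htot : ∏ i ∈ s, J i = ∏ i ∈ s, I i) : ∀ i ∈ s, D i = ⊤ := by
  have hprod : (∏ i ∈ s, I i) * ∏ i ∈ s, D i = ∏ i ∈ s, I i := by
    rw [← Finset.prod_mul_distrib, ← htot]
    exact (Finset.prod_congr rfl fun i hi => hdiv i hi).symm
  have hP : (∏ i ∈ s, I i) ≠ ⊥ := by
    rw [Ne, ← Ideal.zero_eq_bot, Finset.prod_eq_zero_iff]
    rintro ⟨i, hi, h0⟩
    exact hI i hi (by simpa [Ideal.zero_eq_bot] using h0)
  have hQ : (∏ i ∈ s, D i) = ⊤ := eq_top_of_mul_eq_self hP hprod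
  intro i hi
  exact top_le_iff.mp (hQ.symm.le.trans (Ideal.prod_le_inf.trans (Finset.inf_le hi)))

/-- **Corollary: termwise equality.** Under the hypotheses of `factor_eq_top_of_prod_mul_eq`, with
divisibility given as `I i ∣ J i`, the totals `∏ J = ∏ I` force `J i = I i` for every `i ∈ s`.
[cite: JohnsonLeungKings2011, §6.3 (arXiv p0019:L114–127, p0020:L1–22)] -/
theorem eq_of_dvd_of_prod_eq {s : Finset ι} {I J : ι → Ideal Λ}
    (hI : ∀ i ∈ s, I i ≠ ⊥) (hdiv : ∀ i ∈ s, I i ∣ J i)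
    (htot : ∏ i ∈ s, J i = ∏ i ∈ s, I i) : ∀ i ∈ s, J i = I i := by
  classical
  -- choose the cofactors (junk `⊤` off `s`)
  let D : ι → Ideal Λ := fun i => if h : i ∈ s then (hdiv i h).choose else ⊤
  have hD : ∀ i ∈ s, J i = I i * D i := fun i hi => by
    simp only [D, dif_pos hi]
    exact (hdiv i hi).choose_spec
  intro i hi
  rw [hD i hi, factor_eq_top_of_prod_mul_eq hI hD htot i hi, Ideal.mul_top]

end IdealCurrency

/-! ## §S3  The step on a family of JLK skeletons (typed predicates + proved implication) -/

section SkeletonFamily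

variable {Λ : Type*} [CommRing Λ] [IsDomain Λ] [IsNoetherianRing Λ] {ι A : Type*}
  {H0 H1 H2 : ι → Type*}
  [∀ i, AddCommGroup (H0 i)] [∀ i, _root_.Module Λ (H0 i)]
  [∀ i, AddCommGroup (H1 i)] [∀ i, _root_.Module Λ (H1 i)]
  [∀ i, AddCommGroup (H2 i)] [∀ i, _root_.Module Λ (H2 i)]
  (D : ∀ i, ZetaSkeleton Λ A (H0 i) (H1 i) (H2 i))

/-- **(LAM-div)_s — Euler-system divisibility for every character in `s`.** JLK Thm. 6.4 (4) /
Cor. 6.5: `Det_{Λ_𝒪}(H²) ⊂ Det_{Λ_𝒪}(H¹/Λ_𝒪 _𝔞ζ(η))` inside `Q(Λ_𝒪)`, read in `char`-currency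
(`char = Det⁻¹`, JLK §1.3; transcription note (T2) of the tree's JLK file) and for `𝒥_Λ(ζ(η))`
(Lemma 6.6: the quotient `𝒥_Λ/Λ_𝒪 _𝔞ζ` is `Λ/(N𝔞 − σ_𝔞)`, effective as well):
"the Selmer side divides the zeta side". Proved in print for every prime `p` from the twisted
elliptic-unit Euler system ([Rubin2] Thms. 2.3.2–2.3.3). A predicate; nothing asserted.
[cite: JohnsonLeungKings2011, Thm. 6.4 (4) and Cor. 6.5 (arXiv p0018:L64–79, p0019:L1–32), Lemma 6.6 (p0019:L81–112)] -/
def EulerDivisibility (s : Finset ι) : Prop :=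
  ∀ i ∈ s, Module.charIdeal Λ (H2 i) ∣ Module.charIdeal Λ (H1 i ⧸ (D i).Z)

/-- **(LAM-tot)_s — the total identity over the characters of exact level `n`.** JLK §6.3:
`⊗_η Det(𝒥_Λ(ζ(η))) = ⊗_η Det(RΓ(𝒪_K[1/p], Λ(η)(1))[1])`, obtained from Cor. 2.8 (TNC for the
quotient motive `M(K_n(𝔣))/M(K_{n-1}(𝔣))`, i.e. Thm. 2.6 for the two fields: [HK1] Prop. 2.3.1 for
`p ≠ 2`, [It] 3.1 for `p = 2`), Prop. 2.9 ([HK1] 1.2.10 / [It] 1.15) and Nakayama along the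
augmentation (Lemma 6.7), read in `char`-currency. At `p = 2` this predicate carries the WHOLE
[It]-load of (LAM) (weakest sufficient form (ε1a)+(ε1b) of the module docstring). A predicate;
nothing asserted.
[cite: JohnsonLeungKings2011, §6.3 (arXiv p0019:L128–135, p0020:L1–22), Thm. 2.6 and Prop. 2.9 (p0007:L54–58, L101–129)] -/
def TotalCharIdentity (s : Finset ι) : Prop :=
  ∏ i ∈ s, Module.charIdeal Λ (H1 i ⧸ (D i).Z) = ∏ i ∈ s, Module.charIdeal Λ (H2 i)

/-- **JLK §6.3 in the kernel: (LAM-div)_s ∧ (LAM-tot)_s ⇒ the `[MC]` identity `Thm52CharShape` for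
EVERY character in `s`** (nonvanishing of `char(H²)` = `H²` torsion with finite height-one lengths,
the junk-free regime of `Module.charIdeal`). This is the exact place where, at `p = 2`, the
unpublished [It] enters print — through `TotalCharIdentity` ONLY. BSD is not proved by this; no
skeleton is asserted to satisfy the hypotheses.
[cite: JohnsonLeungKings2011, Thm. 5.2 and §6.3 (arXiv p0014:L114–138, p0019:L34–p0020:L22)] -/
theorem thm52CharShape_of_eulerDivisibility_of_totalCharIdentity {s : Finset ι}
    (hdiv : EulerDivisibility D s) (htot : TotalCharIdentity D s)
    (hne : ∀ i ∈ s, Module.charIdeal Λ (H2 i) ≠ ⊥) :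
    ∀ i ∈ s, (D i).Thm52CharShape :=
  fun i hi => eq_of_dvd_of_prod_eq hne hdiv htot i hi

end SkeletonFamily

end Summit.BirchSwinnertonDyer.BirchSwinnertonDyer.Cruxes.ResidualThetaCountLowerPureAtTwo.SideaK1G33
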